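import Mathlib
import HarnessLib
import HarnessLib.Audit
import Summits.AtomisticToContinuum.Statement
import Summits.AtomisticToContinuum.HydrodynamicLimit.Theorems.ImplosionDichotomyHsEosLowDensity
import Summits.AtomisticToContinuum.HydrodynamicLimit.Theorems.HeatBathForgettingAssembly
import Summits.AtomisticToContinuum.HydrodynamicLimit.Theorems.HeatBathForgettingLocalGibbsConcentration
import HarnessLib.Audit.Status.Attr

/-!
Route: FluxGibbsianityLdDrude

DORMANT since 2026-08-24T06:55:21Z (reconciler: no traction for 6.6 d (last activity item-evidence-added at 2026-08-17T16:20:50Z); parked, not closed — `ledger route dormant route-AtomisticToContinuum-FluxGibbsianityLdDrude --off` to re) — unstaffed, not closed; items shared with open routes are served there. `ledger route dormant <id> --off` reactivates.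

Route FluxGibbsianityLdDrude realises idea card ld-drude-flux-gibbsianity (spine); it is the D-0027
§2.1-conforming re-opening of route-AtomisticToContinuum-LdDrudeFluxGibbsianity (retired
2026-08-15T13:44Z `not-a-thesis` by the deciding-theorem audit: its assembly was never rendered and
concluded the Literature constant instead of the sub-problem decl) — same mechanism, same
statements, now with the deciding theorem `closes : KineticFluxLdDecay → KineticWindowGronwall →
EntropyToFields → _root_.HydrodynamicLimit`. IT SUFFICES TO SHOW X = X1 ∧ X2:
X1 (KineticFluxLdDecay, typed) — VANISHING LD-DRUDE FUNCTIONAL OF THE FAST KINETIC CURRENTS: under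
the GLOBAL Gibbs law G_N of N+1 DETERMINISTIC hard spheres on 𝕋³ at fixed small reduced density σ³
(constant profiles a, u₀, θ; G_N is flow-invariant), every bounded one-body observable Σ_i φ(x_i)
g((v_i−u₀)/√θ) with g ⊥ the collision invariants {1, v, |v|²} in L²(Maxwellian) (this covers the
truncated traceless stress and the truncated, re-orthogonalised heat flux) is FAST AT
LARGE-DEVIATION LEVEL over kinetic windows h_N = τ (N+1)^{-1/3} (τ collision times, macroscopically
vanishing): for small amplitude (|φ| ≤ 1, |g| ≤ κ) and every δ > 0 there is a window τ with E_{G_N}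
exp( h_N⁻¹ ∫_0^{h_N} Σ_i φ(x_i(s)) g((v_i(s)−u₀)/√θ) ds ) ≤ e^{δ(N+1)} for all large N — i.e. Λ_∞ :=
inf_τ limsup_N (N+1)⁻¹ log E_{G_N} exp(…) = 0 (τΛ_τ is subadditive by Hölder + invariance, so inf =
lim). Its collisional twin (collisional momentum/energy transfer minus its LINEAR equation-of-state
response) is the informal crux CollisionalFluxLdDecay.
X2 (KineticWindowGronwall, typed as KineticFluxLdDecay → RelEntropyVanishing) — a KINETIC-WINDOW
form of Yau's relative-entropy method for the deterministic torus dynamics: the one-block /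
local-ergodic step (OllaVaradhanYau1993 Thm 3.10) is replaced by the entropy inequality against
exactly the exponential moments of X1 (localised from G_N to the local Gibbs reference over windows
h_N → 0), so that X1 + CollisionalFluxLdDecay + large-velocity tails + the virial equation of state
give the shared typed target RelEntropyVanishing (stmt-AtomisticToContinuum-0766); then the
UNGUARDED Literature hydrodynamic limit by the entropy-inequality dock EntropyToFields
(stmt-AtomisticToContinuum-0769) and the conjunct — since the Statement retype of 2026-08-16
(p126922) the PACKING-GUARDED limit — by `HydrodynamicLimit.of_unguarded`. The guarded twin target
RelEntropyVanishingInBand (stmt-AtomisticToContinuum-17396: 0766 verbatim + the Statement's guard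
ρ_t(x)σ³ < η₀, ∃η₀ outermost) and its dock EntropyToFieldsInBand (stmt-AtomisticToContinuum-17397,
provable now) are filed as the landing place of the pending restate of X2 (VERDICT-lead-a1 on
stmt-AtomisticToContinuum-9282, 2026-08-16T18:16Z: X2 misstated as typed — the antecedent X1 is idle
against Yau's inequality, amplitude wall W1 and reference-law wall W2).
WHY X1 IS THE RIGHT INPUT (informal cruxes FluxGibbsianityDuality, FirstIntegralRigidity): by convex
(Gibbs-variational / Donsker–Varadhan–Kifer) duality Λ_∞(F) = sup_ν [ e_F(ν) − s(ν | G) ] over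
translation-invariant TIME-INVARIANT states ν of the infinite hard-sphere dynamics with finite
two-sided specific relative entropy that arise as local limits of the dynamical tilts G_N e^{Σ avg
F}/Z; hence X1 ⟺ (kinetic) FLUX-GIBBSIANITY: every such extremal state has Maxwellian one-body
velocity marginal (and, for the twin, equilibrium contact statistics) at its own (ρ, u, θ) —
strictly WEAKER than GibbsErgodicity (stmt-AtomisticToContinuum-0779: ν itself a Gibbs mixture),
exactly the flux-level closure isolated by
Literature.Barriers.AtomisticToContinuum.BoltzmannHypothesisBarrierNarrow, and, by the duality,
exactly what the kinetic-window entropy method consumes. FG is attacked not by an ergodic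
decomposition but by a NO-HIDDEN-CONSERVATION-LAW rigidity: Gurevich–Suhov for hard cores
(stationary Gibbsian states have potentials that are first integrals) + classification of
translation-invariant quasi-local first integrals of free flight + binary reflections in d = 3 as
span{N, P, E}.
Lean: `KineticFluxLdDecay ∧ KineticWindowGronwall` — decls of this route file (full one-line terms
in the items; elaborated in Sketch.lean, rc 0). KineticFluxLdDecay := ∀ (a θ : ℝ) (u₀ : V3), 0 < a →
0 < θ → ∃ σ₀ > 0, ∀ σ ∈ (0, σ₀), (∀ N Φ, IsProbabilityMeasure (localGibbsLaw σ a u₀ θ N Φ)) ∧ ∃ κ >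
0, ∀ φ g, Continuous φ → Continuous g → |φ| ≤ 1 → |g| ≤ κ → (∀ (c₀ c₂ : ℝ) (b : V3), ∫ v, g v * (c₀
+ inner ℝ b v + c₂ * ‖v‖ ^ 2) ∂(stdGaussian V3) = 0) → ∀ δ > 0, ∃ τ > 0, ∃ N₀, ∀ N ≥ N₀, ∀ Φ :
HardSphereFlow (Torus.geometry (Fin 3)) (hsDiameter σ N) (N+1), ∫⁻ z, ofReal (exp (h⁻¹ * ∫ s in
0..h, ∑ i, φ (Φ.flow s z i).1 * g ((√θ)⁻¹ • ((Φ.flow s z i).2 − u₀)))) ∂(localGibbsLaw σ a u₀ θ N Φ)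
≤ ofReal (exp (δ (N+1))) with h = τ (N+1)^{-1/3}; KineticWindowGronwall := KineticFluxLdDecay →
RelEntropyVanishing; Assembly := KineticFluxLdDecay → KineticWindowGronwall →
_root_.HydrodynamicLimit (the frame statement X → Statement; its content is the entropy-inequality
dock EntropyToFields = stmt-0769, RelEntropyVanishing → HydrodynamicLimit, closed in tree; restated
2026-08-16 from the tautological rev-1 form that carried EntropyToFields as a third hypothesis,
h21_ground ground.trivial); deciding theorem `closes : KineticFluxLdDecay → KineticWindowGronwall →
EntropyToFields → _root_.HydrodynamicLimit`, proof `fun h₁ h₂ h₃ => HydrodynamicLimit.of_unguarded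
(h₃ (h₂ h₁))` (EntropyToFields = stmt-0769 concludes the unguarded Literature constant; since the
2026-08-16 retype `_root_.HydrodynamicLimit` is the packing-guarded def, reached by
`HydrodynamicLimit.of_unguarded`; rev 7).

Rationale: WHY THIS LINE. The one positive-density Euler derivation (OllaVaradhanYau1993, Thm 2.1) needs its
weak noise in exactly one place, step (B) of the local ergodic theorem (Thm 3.10; §4 steps (A)–(E),
PDF pp. 17–18): limit points of the space–time local process are Gibbs. The card's point, sharpened
by the 2026-08-15 narrowed barrier (BoltzmannHypothesisBarrierNarrow: the method consumes a
FLUX-LEVEL closure, not the classification), is that the entropy inequality ∫F dμ ≤ H(μ|λ) + log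
∫e^F dλ makes the deterministic one-block step EXACTLY the vanishing of a large-deviation functional
Λ_∞ of the window-averaged fast currents under the EQUILIBRIUM dynamics — an "LD-Drude functional"
whose β²-coefficient is the Cesàro-averaged current autocorrelation = ‖P_inv X‖² (Mazur/Suzuki;
tree: Literature.Barriers.AtomisticToContinuum.MazurBoundBallistic, proved Hilbert-space form).
Convex duality (finite-N Gibbs variational principle with explicit optimisers, the dynamical TILTS;
Kifer1990-type LD upper bounds as sup over invariant measures) turns Λ_∞ ≡ 0 into a statement about
STATES: tilted, time-invariant, finite-entropy states carry Eulerian fluxes (flux-Gibbsianity, FG) —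
weaker than "stationary ⇒ Gibbs" (stmt-0779; Bernardin2014 §1.1: macro-ergodicity "sufficient ... we
do not claim necessary"), and attackable by Gibbsian rigidity (GurevichSuhov1976 and sequels;
DobrushinKusuoka1993 pp. 27–28) plus a classification of quasi-local first integrals (no hidden
conservation law for 3-d hard spheres; finite N: Simanyi2013). Imported areas: large deviations /
convex analysis (duality, tilts), ergodic theory of infinite systems (Gurevich–Suhov), integrals of
billiards. What this line does that prior routes do not: RelEntropyErgodic asks the full
classification (0779), ChaoticMixing asks finite-box mixing RATES uniform in n (0830),
VanishingNoise asks noise-uniformity; this route asks only the typed, finite-N, LD-level fastness of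
currents orthogonal to the conserved fields (KineticFluxLdDecay) and offers a state-rigidity proof
plan for it.
RANKED CRUXES. #2 KineticFluxLdDecay [typed] — bounded one-body observables orthogonal to the
collision invariants are LD-fast over kinetic windows under global Gibbs, uniformly in N and in the
flow (why it might fail: a finite-entropy stationary state of the infinite 3-d hard-sphere gas with
non-Maxwellian one-body velocity law — a "current for free" — gives Λ_∞ > 0 by the easy duality
bound; true in d = 1 (rods) and for the free gas (barrier kernel h_C); sources: OllaVaradhanYau1993
Thm 3.10, Spohn1991 §2.4, TothValko2003 p. 10, card). #3 FluxGibbsianityDuality [informal; filed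
after open; needs infinite-volume definitions] — Λ_∞(F) = sup_ν[e_F(ν) − s(ν|G)] over
translation-invariant time-invariant two-sided-finite-entropy local limits of dynamical tilts; hence
KineticFluxLdDecay ⟺ kinetic FG (extremal such ν have Maxwellian one-body velocity marginals at
their own parameters) (why it might fail: upper bound needs exponential tightness, semicontinuity
and existence of the infinite dynamics for limit tilts, Alexander1975 being for equilibrium-type
states; quasi-locality of the tilt potential presumes a light cone; sources: Kifer1990,
OllaVaradhanYau1993 Lemma 4.10, Bernardin2014 §1.1). #4 KineticWindowGronwall [typed:
KineticFluxLdDecay → RelEntropyVanishing] — the kinetic-window relative-entropy method for the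
deterministic torus dynamics, GIVEN ALSO CollisionalFluxLdDecay, large-velocity tails under the true
law (re-posed 0781: truncation is essential, the untruncated cubic heat flux has Λ_τ = +∞) and the
virial EOS identification (0782/0768) (why it might fail: localising the exponential moments from
the invariant G_N to the non-invariant local Gibbs ψ_t costs the window entropy production O(h_N N)
per window and must be summed over ≍ h_N⁻¹ windows — the bookkeeping must close with o(N), and the
tails need a uniform exponential bound nobody has for deterministic hard spheres; sources: Yau1991,
OllaVaradhanYau1993 §3, KipnisLandim1999 Ch. 6). STATUS 2026-08-16: VERDICT-lead-a1 (stmt-9282,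
18:16Z) = MISSTATED as typed — every checked skeleton leaves the antecedent idle (W1: the bounded
class at one amplitude κ cannot pay the cubic truncated heat flux in the Gronwall, Disproof.lean §8;
W2: moving LD bounds from G_N to ψ_t needs one-window LD influence locality at every rate,
stub-false by steered dispersal cascades); all three lines dead; recommended restate
`KineticWindowLDUniform → KineticWindowLDUniformBounded → LocalClampedTransferWindowLDUniform →
TransferActivityTails → EnergyCurrentTails → … → X_RE` with LOCAL-Gibbs, ∀β kinetic inputs — pending
(tenure / verdict repair); after the Statement retype that chain should conclude
RelEntropyVanishingInBand (17396) and needs no DiluteSelfConsistency (3091). #5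
CollisionalFluxLdDecay [informal; after open] — time-integrated collisional momentum/energy transfer
minus its linear EOS response to (ρ, e) is LD-fast (why it might fail: needs LD control of collision
clusters in kinetic windows and EOS differentiability; sources: OllaVaradhanYau1993 §3, Spohn1991
I.3). #6 FirstIntegralRigidity [informal; after open] — (a) Gurevich–Suhov for 3-d hard cores with
summable many-body tilt potentials, (b) quasi-local translation-invariant first integrals of free
flight + binary reflections in d = 3 are spanned by N, P, E (why it might fail: (a) is printed only
for smooth finite-range, finite-body potentials and 1-d hard rods; (b) is false in d = 1; sources:
GurevichSuhov1976, DobrushinKusuoka1993 pp. 27–28, Spohn1991 p. 32, Simanyi2013,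
BoldrighiniBunimovichSinai1983).
SUPPORT. FastObservableMeanErgodic [typed, rank 9] — the L² shadow of #2 (uniform-in-N mean
ergodicity: limsup_N Var_{G_N}(window average)/(N+1) → 0 as τ → ∞; = zero Drude weight + uniformly
integrable correlations; first milestone and cheapest numerical test). RelEntropyVanishing (=
stmt-0766, shared typed target of the Yau-family routes, filed here as target rank 0 so that it
renders before the cruxes that reference it; consumed) and EntropyToFields (= stmt-0769,
RelEntropyVanishing → HydrodynamicLimit, entropy inequality) are attached by signature. Assembly :=
KineticFluxLdDecay → KineticWindowGronwall → _root_.HydrodynamicLimit (frame statement X →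
Statement; content = EntropyToFields, closed in tree as
Theorems.hydrodynamicLimit_of_relEntropyVanishing, so provable in one line; restated 2026-08-16 from
the tautological rev-1 form flagged ground.trivial); the deciding theorem `closes :
KineticFluxLdDecay → KineticWindowGronwall → EntropyToFields → _root_.HydrodynamicLimit` has proof
fun h₁ h₂ h₃ => HydrodynamicLimit.of_unguarded (h₃ (h₂ h₁)) since the 2026-08-16 Statement retype
(p126922; rev 7). RelEntropyVanishingInBand (stmt-17396, target rank 0: the guarded twin of 0766,
canonical guarded X_RE) and EntropyToFieldsInBand (stmt-17397, support: its dock into the guarded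
conjunct, proved in the planner's Sketch.lean from Theorems.tendstoHydroFieldsAt_of_klDiv) are filed
(rev 8) for the pending restate of #4; until then they are outside the cone of `closes`.
LocalGibbsConcentration (= stmt-0767) and HsEosLowDensity (= stmt-0768) are attached as the static
facts KineticWindowGronwall consumes.
KILL CRITERIA. ¬KineticFluxLdDecay closes the route outright (close --reason
refuted:KineticFluxLdDecay): e.g. a translation-invariant, time-invariant, finite-specific-entropy
state of infinite 3-d hard spheres at arbitrarily small density with non-Maxwellian one-body
velocity law or anisotropic stress (also kills 0779 and ChaoticMixing's premise), or an N-growing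
plateau of (N+1)⁻¹ log E_G exp(Σ avg_τ σ_xy) in τ. ¬FastObservableMeanErgodic (a positive
uniform-in-N Drude weight of a bounded observable ⊥ collision invariants, i.e. a hidden quasi-local
conserved quantity) kills #2 a fortiori. ¬FirstIntegralRigidity(b) (a hidden quadratic-in-velocity
quasi-local integral of 3-d hard spheres) forces a pivot of the proof plan (FG might survive via
ergodic arguments) but makes the route dormant. ¬RelEntropyVanishing by entropy production ≥ cN
before the first shock INSIDE the dilute band closes this and every Yau-family route;
¬RelEntropyVanishing by an implosion / dense-excursion witness (the over-strength the 2026-08-16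
retype removed from the conjunct) only forces re-docking `closes` on RelEntropyVanishingInBand
(17396) + EntropyToFieldsInBand (17397). RelEntropyVanishing proved elsewhere (routes
RelEntropyErgodic / ChaoticMixing / VanishingNoise) moots #4 but not #2–#3 as mathematics.
NOT DECOMPOSED YET. The localisation G_N ↔ ψ_t over windows (child of #4); the tail/truncation
statement under the true law (child of #4, to be shared with a re-posed 0781); the EOS/virial
identification of the response coefficients (0782/0768, children of #4/#5); the typed form of #3 and
#5 (wait for the definition requests: infinite-volume hard-sphere states and flow, specific relative
entropy, collisional transfer functional); the split FG ⇐ (a) + (b) of #6; constants κ, the window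
normalisation (mean free time vs (N+1)^{-1/3} — immaterial for inf_τ), isotropy reductions. All are
layer-2 children, filed by glued splits when a crux moves (D-0019).
CHEAPEST FALSIFIER. (i) Paper: do the algebra of #6(b) for ONE- and TWO-body functionals — a
translation-invariant pair functional Σ_{i<j} f(x_i − x_j, v_i, v_j), smooth off contact, invariant
under free flight and every binary reflection, other than combinations of N, P, E and constants,
kills the rigidity plan instantly (the one-body case is the Boltzmann–Gronwall theorem, in tree:
Literature.MathematicalPhysics.KineticTheory.IsCollisionInvariant.exists_eq_quadratic_holds). (ii)
Lookup: any printed non-Gibbs translation-invariant stationary state of finite specific entropy for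
3-d hard spheres (none known to OVY 1993, Spohn 1991, Bernardin 2014, or the 0779 grounders). (iii)
Numerics (kit): event-driven MD of N = 10³–10⁵ hard spheres at packing fraction 0.05: finite-size
scaling of (N+1)⁻¹ log E_G exp(β Σ_i avg_τ σ_xy,i) and of Var/(N+1) versus τ; a plateau growing with
N refutes #2 / FastObservableMeanErgodic. Not run here (plancard seat, one-shot).
TWO-LAYER PLAN. #2 ⇐ FluxGibbsianityDuality(upper bound) → KineticFG → #2 once #3 is typed; #4 ⇐
Localisation → TailsUnderTrueLaw → (X1 ∧ #5 ∧ tails ∧ EOS → RelEntropyVanishing); #6 ⇐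
GurevichSuhovHardCore → FirstIntegralClassification → FG. k ≤ 3 each, depth 1; nothing filed now.
NUMBERS. Window h_N = τ (N+1)^{-1/3} macroscopic = τ × O(σ⁻² θ^{-1/2}) mean free times;
hydrodynamic-fluctuation contribution to Λ_τ is O(τ^{-3/2}) (shear modes of wavelength ≳ √τ mean
free paths survive the average), so Λ_τ > 0 at every finite τ and only inf_τ vanishes; Gibbs tilts
(u′, θ′) are unprofitable for |g| ≤ κ₀ (absolute constant after standardisation) since ∫ g
dM_{u′,θ′} is second order at (0, θ) for g ⊥ collision invariants while the specific entropy cost is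
uniformly convex there; untruncated cubic heat flux: Λ_τ = +∞ (one sphere of energy ≍ N costs O(N)
nats, gains ≍ N^{3/2}) — hence bounded g only.
SOURCES. OllaVaradhanYau1993 (Thm 2.1 p. 9, Thm 3.10 p. 15, steps (A)–(E) pp. 17–18, Lemma 4.10 p.
24 — PDF pages, held); Yau1991; Spohn1991 (Part I §2.4 p. 25, notes p. 32 = PDF p. 39, Ch. 3);
Bernardin2014 = arXiv:1407.7023 §1.1; Kifer1990 = doi:10.2307/2001571; GurevichSuhov1976 =
doi:10.1007/bf01608637 (+ doi:10.1007/bf01609838, doi:10.1007/bf01208482); DobrushinKusuoka1993 =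
doi:10.1007/bfb0074238 pp. 27–28 (PDF); Simanyi2013 = arXiv:1007.1206;
BoldrighiniBunimovichSinai1983; Alexander1975; TothValko2003 = arXiv:math/0210426; KipnisLandim1999
Ch. 6 and App. 1 Prop. 8.2; LepriLiviPoliti2003 §8 (Mazur); Doyon2022 (hydrodynamic projections);
LiveraniOlla1996; FritzFunakiLebowitz1994.
DEFINITION REQUESTS. (1) InfiniteHardSphereDynamics — locally finite hard-sphere configurations of
ℝ³ × ℝ³ (reuse Literature.Analysis.FunctionSpaces.PointConfig), translation action, Alexander1975
a.s.-defined flow for translation-invariant finite-density states; (2) HardSphereSpecificRelEntropy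
— grand-canonical hard-sphere Gibbs state g_{z,u,β} on ℝ³ (DLR) and the specific relative entropy
s(ν | g) of a translation-invariant state (both also wanted by stmt-0779); (3)
CollisionalTransferAlongFlow — time-integrated collisional momentum / energy transfer of a
HardSphereFlow trajectory tested against a field on 𝕋³ (also wanted by stmt-0782). Filed with
`ledger workitem add --kind definition` against cruxes #3 / #5 after open.

Novelty: Searches (2026-08-15, this seat): lit search --hybrid "large deviations time averaged current
invariant measures variational formula hydrodynamic limit deterministic dynamics" (12 docs:
KipnisLandim1999, SaintRaymond2009, Spohn1991, DeMasiPresutti1991, Gaspard1998 LD formalism/Helfand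
moments, …; none states an LD-level flux closure for Hamiltonian particles); lit search --hybrid
"Gurevich Suhov stationary solutions of the Bogoliubov hierarchy … Gibbs first integrals" (10 docs;
read Spohn1991 PDF p. 39 = notes to §2.4 and DobrushinKusuoka1993 PDF pp. 27–28: Gurevich–Suhov
restrict a priori to Gibbsian states with finite-body non-pair potentials and prove the potential is
the dynamics' one); lit frontier AtomisticToContinuum --since 2020 (30 rows: arXiv:2310.13338 heat
equation from deterministic dynamics = ChaoticMixing's engine, arXiv:2603.18522 hard-rod generalized
hydrodynamics = the d = 1 caveat; nothing on LD-Drude / flux closure); lit bridges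
AtomisticToContinuum --cross any (30 rows, no hit on the mechanism); lit read OllaVaradhanYau1993
pp. 3, 9, 15, 17–18, 24 (Thm 2.1, Thm 3.10 local ergodic theorem, steps (A)–(E), Lemma 4.10); lit
galaxy search ×4 ("invariant measures with correct Euler currents …", "large deviations of
time-averaged current Hamiltonian …", "stationary solutions of the Bogoliubov hierarchy", "mazur
bound hard spheres") — galaxy service saturated at 11:30–11:45Z (queued > 90 s / 0 rows): logged,
not relied on; plus the plain `lit search` daemon was r  [refs: 10.2307/2001571, 10.1007/bf01608637, 10.1007/bf01609838, 10.1007/bf01208482, 2310.13338, 2603.18522, 1407.7023, math/0210426, 2011.00611, doi:10.2307/2001571, doi:10.1007/bf01608637, doi:10.1007/bf01609838, doi:10.1007/bf01208482, KipnisLandim1999, SaintRaymond2009, Spohn1991, Gaspard1998, DobrushinKusuoka1993, OllaVaradhanYau1993, Bernardin2014, TothValko2003, Kifer1990, GurevichSuhov1976]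

Barriers (technique_class: relative-entropy large-deviations invariant-states): - technique_class: relative-entropy large-deviations invariant-states
- Literature.Barriers.AtomisticToContinuum.BoltzmannHypothesisBarrierNarrow: met head-on and ADOPTED
as the route's frame, not evaded: the narrowed barrier (audit 2026-08-15) says the entropy method
consumes a FLUX-LEVEL closure on regular stationary states, that the failure of the classification
does not by itself obstruct it (kernel (2)–(4)), and that the free gas violates the closure (kernel
(5): h_C has a rest-frame heat current). KineticFluxLdDecay is the finite-N, LD-level, typed form of
exactly that closure for the kinetic currents; kernel (5) is a witness that it FAILS without
collisions (φ ≡ 1, g = a bounded re-orthogonalised heat-flux component is then conserved, Λ_τ = Λ_0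
> 0 for all τ), so the role of collisions is explicit and nothing refuted is re-wanted; the
barrier's scope caveat (b) ("a proof of either [the classification or its flux-level corollary] for
hard spheres at small reduced density evades it") is precisely the bet.
- Literature.Barriers.AtomisticToContinuum.BoltzmannHypothesisBarrier: weakened, not evaded — the
needed input is "tilted stationary states carry Eulerian one-body/contact fluxes", not "stationary ⇒
Gibbs mixture" (stmt-0779); its formal kernel (ideal gas, arbitrary velocity law h) is a case where
flux-Gibbsianity is false and KineticFluxLdDecay is false, consistently.
- Literature.Barriers.AtomisticToContinuum.MacroErgodicityBarrier: applies in spirit (same missing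
inp

History (route lifecycle, newest last):
- 2026-08-15T16:31:21Z · rev 2: restated KineticFluxLdDecay (stmt-AtomisticToContinuum-9281) — cone repair 1/3 (route-repair, repair_kind=cone): restate KineticFluxLdDecay 1:1 with the orthogonality clause unfolded to Mathlib only — (∀ ψ ∈ Literature.Anal (planner-rrepair-AtomisticToContinuum-FluxGibbs-f94f2339-g2-0)
- 2026-08-15T16:32:25Z · rev 3: restated FastObservableMeanErgodic (stmt-AtomisticToContinuum-9283) — cone repair 2/3 (route-repair, repair_kind=cone): restate the support item FastObservableMeanErgodic 1:1 with the same Mathlib-only orthogonality clause as Kine (planner-rrepair-AtomisticToContinuum-FluxGibbs-f94f2339-g2-0)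
- 2026-08-16T18:30:36Z · rev 5: restated Assembly (stmt-AtomisticToContinuum-9284) — route-repair (ground-failed): restate Assembly 1:1 as the faithful frame statement X → Statement (X = KineticFluxLdDecay ∧ KineticWindowGronwall): drop the thir (planner-rground-AtomisticToContinuum-FluxGibbsi-f94f2339-0)
- 2026-08-24T06:55:21Z · DORMANT — reconciler: no traction for 6.6 d (last activity item-evidence-added at 2026-08-17T16:20:50Z); parked, not closed — `ledger route dormant route-AtomisticToConti (operator:999:3848001)

sub-problem: HydrodynamicLimit · status: dormant · opened planner-plancard-AtomisticToContinuum-Hydrody-a15e8232-0 2026-08-15T13:55:07Z · rev 9 · ledger route-AtomisticToContinuum-FluxGibbsianityLdDrude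
GENERATED by the gate from the ledger (D-0016/17). Provers cite these decls: `theorem foo : Summit.AtomisticToContinuum.HydrodynamicLimit.Theses.FluxGibbsianityLdDrude.<Decl> := …` in Summits/AtomisticToContinuum/HydrodynamicLimit/Theorems/<Name>.lean.
-/

namespace Summit.AtomisticToContinuum.HydrodynamicLimit.Theses.FluxGibbsianityLdDrude

open scoped BigOperators Topology Manifold Classical MeasureTheory ProbabilityTheory Matrix InnerProductSpace ComplexConjugate ContinuousMap
open Filter Set Function TopologicalSpace MeasureTheory

attribute [summit_statement] _root_.HydrodynamicLimit

/-- item stmt-AtomisticToContinuum-0766 · target · rank 0 · open · by planner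
why it might fail: Entropy production ≥ cN before the first shock for some smooth data (non-Gibbsian mesoscopic structure of deterministic hard spheres at fixed σ) refutes it and every Yau-family route; OllaVaradhanYau1993 Thm 2.1 needs noise exactly here.
sources: Yau1991, OllaVaradhanYau1993, Thm 2.1 p. 9
[target] X_RE: for all continuous profiles ∃ σ₀ ∀ σ<σ₀ ∀ classical hs-Euler solutions on [0,T) ∀
flows: the initial local Gibbs laws are probability measures and, if their fields converge at t=0,
then ∀ t<T ∃ activity profile a_t such that the reference local Gibbs law (a_t, u_t, θ_t) is a
probability measure whose empirical density/momentum/energy fields concentrate exponentially (≤ C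
e^{-(N+1)/C}) around (ρ,ρu,E)(t), and klDiv(lawAt Φ_N (localGibbs a₀u₀θ₀) t ‖ localGibbs a_t u_t
θ_t)/(N+1) → 0. Yau1991; OllaVaradhanYau1993 Thm 1.1 (with noise). -/
@[route_item "route-AtomisticToContinuum-FluxGibbsianityLdDrude"]
def RelEntropyVanishing : Prop :=
  ∀ (a₀ θ₀ : Literature.MathematicalPhysics.KineticTheory.T3 → ℝ) (u₀ : Literature.MathematicalPhysics.KineticTheory.T3 → Literature.MathematicalPhysics.KineticTheory.V3), Continuous a₀ → Continuous θ₀ → Continuous u₀ → (∀ x, 0 < a₀ x) → (∀ x, 0 < θ₀ x) → ∃ σ₀ : ℝ, 0 < σ₀ ∧ ∀ σ : ℝ, 0 < σ → σ < σ₀ → ∀ (T : ℝ) (ρ θ : ℝ → Literature.MathematicalPhysics.KineticTheory.T3 → ℝ) (u : ℝ → Literature.MathematicalPhysics.KineticTheory.T3 → Literature.MathematicalPhysics.KineticTheory.V3), Literature.MathematicalPhysics.KineticTheory.IsHardSphereEulerSolution σ T ρ u θ → ∀ Φ : (N : ℕ) → Literature.Analysis.FluidPDE.HardSphereFlow (Literature.Analysis.FluidPDE.Torus.geometry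 (Fin 3)) (Literature.MathematicalPhysics.KineticTheory.hsDiameter σ N) (N + 1), (∀ N, MeasureTheory.IsProbabilityMeasure (Literature.MathematicalPhysics.KineticTheory.localGibbsLaw σ a₀ u₀ θ₀ N (Φ N))) ∧ (Literature.MathematicalPhysics.KineticTheory.TendstoHydroFieldsAt (fun N => Literature.MathematicalPhysics.KineticTheory.localGibbsLaw σ a₀ u₀ θ₀ N (Φ N)) Φ ρ u θ 0 → ∀ t ∈ Set.Ico 0 T, ∃ a : Literature.MathematicalPhysics.KineticTheory.T3 → ℝ, (∀ N, MeasureTheory.IsProbabilityMeasure (Literature.MathematicalPhysics.KineticTheory.localGibbsLaw σ a (u t) (θ t) N (Φ N))) ∧ (∀ χ : Literature.MathematicalPhysics.KineticTheory.T3 → ℝ, Continuous χ → ∀ δ : ℝ, 0 < δ → ∃ C : ℝ, 0 < C ∧ ∀ N : ℕ, Literature.MathematicalPhysics.KineticTheory.localGibbsLaw σ a (u t) (θ t) N (Φ N) {z | δ < |Literature.MathematicalPhysics.KineticTheory.empiricalDensityField z χ - ∫ x, χ x * ρ t x|} ≤ ENNReal.ofReal (C * Real.exp (-(C⁻¹ *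 (N + 1)))) ∧ Literature.MathematicalPhysics.KineticTheory.localGibbsLaw σ a (u t) (θ t) N (Φ N) {z | δ < ‖Literature.MathematicalPhysics.KineticTheory.empiricalMomentumField z χ - ∫ x, (χ x * ρ t x) • u t x‖} ≤ ENNReal.ofReal (C * Real.exp (-(C⁻¹ * (N + 1)))) ∧ Literature.MathematicalPhysics.KineticTheory.localGibbsLaw σ a (u t) (θ t) N (Φ N) {z | δ < |Literature.MathematicalPhysics.KineticTheory.empiricalEnergyField z χ - ∫ x, χ x * Literature.MathematicalPhysics.KineticTheory.totalEnergyDensity (ρ t x) (u t x) (θ t x)|} ≤ ENNReal.ofReal (C * Real.exp (-(C⁻¹ * (N + 1))))) ∧ Filter.Tendsto (fun N : ℕ => InformationTheory.klDiv ((Φ N).lawAt (Literature.MathematicalPhysics.KineticTheory.localGibbsLaw σ a₀ u₀ θ₀ N (Φ N)) t) (Literature.MathematicalPhysics.KineticTheory.localGibbsLaw σ a (u t) (θ t) N (Φ N)) / ((N : ENNReal) + 1)) Filter.atTop (nhds 0))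

/-- item stmt-AtomisticToContinuum-17396 · target · rank 0 · open · by planner
why it might fail: Entropy production ≥ cN before the first shock INSIDE the dilute band (non-Gibbsian mesoscopic structure of deterministic hard spheres at fixed small σ) refutes it and every Yau-family route; implosion / dense-excursion witnesses no longer bear on it.
sources: Yau1991, OllaVaradhanYau1993, Thm 2.1 p. 9, Spohn1991, Part I Ch. 3 §3.2 (3.21)
[target] PACKING-GUARDED X_RE — the shared Yau-form target stmt-AtomisticToContinuum-0766 made to
match the RE-TYPED conjunct (Statement retype p126922, 2026-08-16: `_root_.HydrodynamicLimit` is now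
the packing-guarded limit, ∃ η₀ outermost, guard ∀ t ∈ [0,T) ∀ x, ρ_t(x)σ³ < η₀ after the solution
hypothesis): there is η₀ > 0 (prover-chosen) such that for all continuous positive profiles ∃ σ₀ ∀
0<σ<σ₀ ∀ T ∀ classical hs-Euler solutions (ρ,u,θ) on [0,T) WHOSE LOCAL PACKING STAYS BELOW η₀ ∀ flow
families Φ: the initial local Gibbs laws are probability measures and, if their empirical fields
converge at t = 0, then ∀ t < T ∃ activity profile a_t such that the reference local Gibbs law (a_t,
u_t, θ_t) is a probability measure whose density/momentum/energy fields concentrate exponentially (≤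
C e^{-(N+1)/C}) around (ρ, ρu, E)(t) and klDiv(lawAt Φ_N (localGibbs a₀ u₀ θ₀) t ‖ localGibbs a_t
u_t θ_t)/(N+1) → 0. CANONICAL FORM: 0766 verbatim with the Statement's guard clause inserted at the
Statement's position and `∃ η₀ : ℝ, 0 < η₀ ∧` prefixed — sibling Yau-family routes re-targeting
after the retype should attach to THIS signature (dedup). 0766 ⇒ this (take η₀ := 1 and ignore the
guard; Ske -/
@[route_item "route-AtomisticToContinuum-FluxGibbsianityLdDrude"]
def RelEntropyVanishingInBand : Prop :=
  ∃ η₀ : ℝ, 0 < η₀ ∧ ∀ (a₀ θ₀ : Literature.MathematicalPhysics.KineticTheory.T3 → ℝ) (u₀ : Literature.MathematicalPhysics.KineticTheory.T3 → Literature.MathematicalPhysics.KineticTheory.V3), Continuous a₀ → Continuous θ₀ → Continuous u₀ → (∀ x, 0 < a₀ x) → (∀ x, 0 < θ₀ x) → ∃ σ₀ : ℝ, 0 < σ₀ ∧ ∀ σ : ℝ, 0 < σ → σ < σ₀ → ∀ (T : ℝ) (ρ θ : ℝ → Literature.MathematicalPhysics.KineticTheory.T3 → ℝ) (u : ℝ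 → Literature.MathematicalPhysics.KineticTheory.T3 → Literature.MathematicalPhysics.KineticTheory.V3), Literature.MathematicalPhysics.KineticTheory.IsHardSphereEulerSolution σ T ρ u θ → (∀ t ∈ Set.Ico 0 T, ∀ x, ρ t x * σ ^ 3 < η₀) → ∀ Φ : (N : ℕ) → Literature.Analysis.FluidPDE.HardSphereFlow (Literature.Analysis.FluidPDE.Torus.geometry (Fin 3)) (Literature.MathematicalPhysics.KineticTheory.hsDiameter σ N) (N + 1), (∀ N, MeasureTheory.IsProbabilityMeasure (Literature.MathematicalPhysics.KineticTheory.localGibbsLaw σ a₀ u₀ θ₀ N (Φ N))) ∧ (Literature.MathematicalPhysics.KineticTheory.TendstoHydroFieldsAt (fun N => Literature.MathematicalPhysics.KineticTheory.localGibbsLaw σ a₀ u₀ θ₀ N (Φ N)) Φ ρ u θ 0 → ∀ t ∈ Set.Ico 0 T, ∃ a : Literature.MathematicalPhysics.KineticTheory.T3 → ℝ, (∀ N, MeasureTheory.IsProbabilityMeasure (Literature.MathematicalPhysics.KineticTheory.localGibbsLaw σ a (u t) (θ t) N (Φ N))) ∧ (∀ χ : Literature.MathematicalPhysics.KineticTheory.T3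 → ℝ, Continuous χ → ∀ δ : ℝ, 0 < δ → ∃ C : ℝ, 0 < C ∧ ∀ N : ℕ, Literature.MathematicalPhysics.KineticTheory.localGibbsLaw σ a (u t) (θ t) N (Φ N) {z | δ < |Literature.MathematicalPhysics.KineticTheory.empiricalDensityField z χ - ∫ x, χ x * ρ t x|} ≤ ENNReal.ofReal (C * Real.exp (-(C⁻¹ * (N + 1)))) ∧ Literature.MathematicalPhysics.KineticTheory.localGibbsLaw σ a (u t) (θ t) N (Φ N) {z | δ < ‖Literature.MathematicalPhysics.KineticTheory.empiricalMomentumField z χ - ∫ x, (χ x * ρ t x) • u t x‖} ≤ ENNReal.ofReal (C * Real.exp (-(C⁻¹ * (N + 1)))) ∧ Literature.MathematicalPhysics.KineticTheory.localGibbsLaw σ a (u t) (θ t) N (Φ N) {z | δ < |Literature.MathematicalPhysics.KineticTheory.empiricalEnergyField z χ - ∫ x, χ x * Literature.MathematicalPhysics.KineticTheory.totalEnergyDensity (ρ t x) (u t x) (θ t x)|} ≤ ENNReal.ofReal (C * Real.exp (-(C⁻¹ * (N + 1))))) ∧ Filter.Tendsto (fun N : ℕ => InformationTheory.klDiv ((Φ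 N).lawAt (Literature.MathematicalPhysics.KineticTheory.localGibbsLaw σ a₀ u₀ θ₀ N (Φ N)) t) (Literature.MathematicalPhysics.KineticTheory.localGibbsLaw σ a (u t) (θ t) N (Φ N)) / ((N : ENNReal) + 1)) Filter.atTop (nhds 0))

-- earlier KineticFluxLdDecay (stmt-AtomisticToContinuum-9281, replaced 2026-08-15T16:31:21Z -> stmt-AtomisticToContinuum-10967): retired by None — ∀ (a θ : ℝ) (u₀ : Literature.MathematicalPhysics.KineticTheory.V3), 0 < a → 0 < θ → ∃ σ₀ : ℝ, 0 < σ₀ ∧ ∀ σ : ℝ, 0 < σ → σ < σ₀ → (∀ (N : ℕ) (Φ : Literature.Analysis.FluidPDE.HardSphereFlow (Literature.Analysis.FluidPDE.Torus.geometry (Fin 3)) (Literature.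
/-- item stmt-AtomisticToContinuum-10967 · crux · rank 2 · open · by planner
why it might fail: A finite-entropy translation- and time-invariant state of infinite 3-d hard spheres at small density with non-Maxwellian one-body velocity law gives Λ_∞ > 0 (easy duality bound), as for the free gas (barrier kernel h_C) and d = 1 rods; no decay estimate uniform in N exists for deterministic spheres.
sources: OllaVaradhanYau1993, Thm 3.10 p. 15 and §4 pp. 17-18, Spohn1991, Part I §2.4 p. 25, TothValko2003 = arXiv:math/0210426, p. 10, Kifer1990 = doi:10.2307/2001571, LepriLiviPoliti2003, §8 (Mazur)
[crux] LD-DRUDE VANISHING FOR FAST KINETIC OBSERVABLES (card ld-drude-flux-gibbsianity, step 1,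
kinetic part; = finite-N LD form of kinetic flux-Gibbsianity). For every activity a > 0, temperature
θ > 0, drift u₀ there is σ₀ > 0 such that for 0 < σ < σ₀ the constant-profile local Gibbs laws G_N =
localGibbsLaw σ a u₀ θ (global Gibbs; flow-invariant) are probability measures and there is an
amplitude κ > 0 with: for all continuous φ : 𝕋³ → ℝ with |φ| ≤ 1 and continuous g : ℝ³ → ℝ with |g|
≤ κ and g ⊥ collisionInvariants (maxwellianInner g ψ = 0 for ψ ∈ span{1, v, |v|²}, i.e. ∫ g ψ d
stdGaussian = 0), for every δ > 0 there are τ > 0 and N₀ with, for all N ≥ N₀ and EVERY hard-sphere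
flow Φ of N+1 spheres of diameter σ(N+1)^{-1/3} on 𝕋³: ∫ exp( h⁻¹ ∫_0^h Σ_i φ(x_i(s)) g((v_i(s) −
u₀)/√θ) ds ) dG_N ≤ exp(δ (N+1)), h = τ (N+1)^{-1/3} (a kinetic window: τ × O(1) mean free times,
macroscopically → 0). Equivalently Λ_∞(φ⊗g) := inf_τ limsup_N (N+1)⁻¹ log E_{G_N} e^{…} = 0 (Λ_τ ≥ 0
by Jensen since the mean is 0; τΛ_τ is subadditive by Hölder + invariance, so inf = lim). Covers the
truncated traceless stress g = J:(w⊗w − |w|²/3)𝟙_{|w|≤A} and the truncated re-orthogonalised heat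
flux. The ampli -/
@[route_item "route-AtomisticToContinuum-FluxGibbsianityLdDrude", crux]
def KineticFluxLdDecay : Prop :=
  ∀ (a θ : ℝ) (u₀ : Literature.MathematicalPhysics.KineticTheory.V3), 0 < a → 0 < θ → ∃ σ₀ : ℝ, 0 < σ₀ ∧ ∀ σ : ℝ, 0 < σ → σ < σ₀ → (∀ (N : ℕ) (Φ : Literature.Analysis.FluidPDE.HardSphereFlow (Literature.Analysis.FluidPDE.Torus.geometry (Fin 3)) (Literature.MathematicalPhysics.KineticTheory.hsDiameter σ N) (N + 1)), MeasureTheory.IsProbabilityMeasure (Literature.MathematicalPhysics.KineticTheory.localGibbsLaw σ (fun _ => a) (fun _ => u₀) (fun _ => θ) N Φ)) ∧ ∃ κ : ℝ, 0 < κ ∧ ∀ (φ : Literature.MathematicalPhysics.KineticTheory.T3 → ℝ) (g : Literature.MathematicalPhysics.KineticTheory.V3 → ℝ), Continuous φ → Continuous g → (∀ x, |φ x| ≤ 1) → (∀ v, |g v| ≤ κ) → (∀ (c₀ c₂ : ℝ) (b : Literature.MathematicalPhysics.KineticTheory.V3), ∫ v, g v * (c₀ + inner ℝ b v + c₂ *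 ‖v‖ ^ 2) ∂(ProbabilityTheory.stdGaussian Literature.MathematicalPhysics.KineticTheory.V3) = 0) → ∀ δ : ℝ, 0 < δ → ∃ τ : ℝ, 0 < τ ∧ ∃ N₀ : ℕ, ∀ N : ℕ, N₀ ≤ N → ∀ Φ : Literature.Analysis.FluidPDE.HardSphereFlow (Literature.Analysis.FluidPDE.Torus.geometry (Fin 3)) (Literature.MathematicalPhysics.KineticTheory.hsDiameter σ N) (N + 1), ∫⁻ z, ENNReal.ofReal (Real.exp ((τ * ((N + 1 : ℕ) : ℝ) ^ (-(1 / 3 : ℝ)))⁻¹ * ∫ s in (0 : ℝ)..(τ * ((N + 1 : ℕ) : ℝ) ^ (-(1 / 3 : ℝ))), ∑ i, φ (Φ.flow s z i).1 * g ((Real.sqrt θ)⁻¹ • ((Φ.flow s z i).2 - u₀)))) ∂(Literature.MathematicalPhysics.KineticTheory.localGibbsLaw σ (fun _ => a) (fun _ => u₀) (fun _ => θ) N Φ) ≤ ENNReal.ofReal (Real.exp (δ * (N + 1)))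

-- item stmt-AtomisticToContinuum-9559 · crux · rank 3 · open · by planner — informal only, no Lean statement yet:
--   [crux] CONVEX-DUALITY (VARIATIONAL) FORMULA + KINETIC FLUX-GIBBSIANITY (card
--   ld-drude-flux-gibbsianity, steps 2–3; informal until the infinite-volume definitions land — requests
--   filed). Setting of KineticFluxLdDecay: σ < σ₀, constant (a, u₀, θ), bounded continuous one-body
--   observable F = φ⊗g with g ⊥ collision invariants; Λ_τ(F) := limsup_N (N+1)⁻¹ log E_{G_N} exp(Σ_i
--   window-average of F over h_N = τ(N+1)^{-1/3}); Λ_∞ := inf_τ Λ_τ (= lim: τΛ_τ subadditive by Hölder +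
--   flow-invariance of G_N; Λ_τ ≥ 0 by Jensen). At finite N the Gibbs variational principle is exact,
--   log E_G e^Y = sup_ν [E_ν Y − H

/-- item stmt-AtomisticToContinuum-9282 · crux · rank 4 · open · by planner
why it might fail: Localising exponential moments from the invariant G_N to the non-invariant local Gibbs ψ_t costs O(h_N·N) entropy per window over ≍ T/h_N windows — O(N) in total unless block-freezing gains a factor; and the tail needs uniform exponential control of truncated heat currents under the TRUE law.
sources: Yau1991, OllaVaradhanYau1993, §3 pp. 11-17, KipnisLandim1999, Ch. 6 pp. 126-134
[crux] KINETIC-WINDOW RELATIVE-ENTROPY METHOD (card step 2, sufficiency half of the duality;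
companion card kinetic-windows-inside-yau): KineticFluxLdDecay → RelEntropyVanishing. With f_t the
true time-t law (lawAt Φ_N of the local Gibbs datum) and ψ_t the local Gibbs reference driven by the
classical hs-Euler solution, integrate dH_N(f_t|ψ_t)/dt over kinetic windows [t, t + h_N], h_N =
τ(N+1)^{-1/3}: positions move O(h_N), the integrand is Σ_i ∇λ(t, x_i) · (window-averaged microscopic
current − Euler flux at the reference) + ∂_t log-partition terms; split the current into (kinetic
part orthogonal to the collision invariants in the local frame) + (collisional transfer minus linear
EOS response) + (conserved-field part, cancelled by the Euler equations for λ as in Yau1991) +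
(high-velocity tail); bound the first by the entropy inequality ∫X df ≤ β⁻¹[H(f|ψ) + log ∫ e^{βX}
dψ] with log ∫ e^{βX} dψ_t ≤ N(Λ_τ + o(1)) after LOCALISING the exponential moment from the
invariant G_N (constant profiles, where KineticFluxLdDecay applies) to ψ_t (window entropy
production O(h_N N), block freezing of λ), the second by CollisionalFluxLdDecay (informal crux of
this route, GIVEN), the tail by a tr -/
@[route_item "route-AtomisticToContinuum-FluxGibbsianityLdDrude", crux]
def KineticWindowGronwall : Prop :=
  KineticFluxLdDecay → RelEntropyVanishing

-- item stmt-AtomisticToContinuum-9560 · crux · rank 5 · open · by planner — informal only, no Lean statement yet: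
--   [crux] COLLISIONAL LD-DRUDE VANISHING (card step 1: 'collisional excess', collisional shear and heat
--   transfer; informal until a collisional-transfer functional along HardSphereFlow is defined — request
--   filed, shared with stmt-0782). Setting of KineticFluxLdDecay (global Gibbs G_N at σ < σ₀, constant
--   (a, u₀, θ), kinetic windows h = τ(N+1)^{-1/3}). For a smooth vector field Ĵ : 𝕋³ → ℝ³ let W_Ĵ(z, h)
--   := time-integrated COLLISIONAL momentum transfer against Ĵ over (0, h] = Σ over collisions (i, j,
--   t_c ≤ h) of (Ĵ(x_i(t_c)) − Ĵ(x_j(t_c)))·Δv_i; on good z equivalently [Σ_i Ĵ(x_i)·(v_i − u₀)]_0^h −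
--   ∫_

-- item stmt-AtomisticToContinuum-9561 · crux · rank 6 · open · by planner — informal only, no Lean statement yet:
--   [crux] NO-HIDDEN-CONSERVATION-LAW RIGIDITY (card step 4: the proposed PROOF of flux-Gibbsianity,
--   replacing an ergodic decomposition; informal). (a) GUREVICH–SUHOV FOR HARD CORES in d = 3: a
--   translation-invariant state of the infinite hard-sphere system that is Gibbsian (DLR) for a formal
--   interaction 'hard core + W', W a translation-invariant quasi-local functional with summable
--   many-body expansion (the limit dynamical tilts of FluxGibbsianityDuality are of this form when W =
--   time-averaged current has a light cone), and that is TIME-INVARIANT (stationary solution of the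
--   hard-sphere BBGKY hierar

/-- item stmt-AtomisticToContinuum-0768 · support · rank 9 · closed · proved by Summit.AtomisticToContinuum.HydrodynamicLimit.Theorems.hsEosLowDensity_proof (prover) · by planner
sources: Ruelle1969, §3.4
[support] Hard-sphere equation of state at low density: ∃ η₀ > 0 and F real-analytic on (−η₀, η₀)
with hsExcessFreeEnergy = F on [0, η₀), F(0) = 0, F'(0) = 2π/3 (second virial coefficient of
unit-diameter spheres), and the canonical thermodynamic limit −N⁻¹ log hsFreeVolume η N → F(η)
exists (not just limsup) for η ∈ [0, η₀). Ruelle1969 §3.4 (existence), LebowitzPenrose1964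
(convergence of the virial expansion ⇒ analyticity). Makes hsCompressibility/hsPressure smooth and
Z(η) = 1 + (2π/3)η + O(η²); needed by every route (hyperbolicity of the Euler system, virial
theorem). -/
@[route_item "route-AtomisticToContinuum-FluxGibbsianityLdDrude"]
def HsEosLowDensity : Prop :=
  ∃ η₀ : ℝ, 0 < η₀ ∧ ∃ F : ℝ → ℝ, AnalyticOnNhd ℝ F (Set.Ioo (-η₀) η₀) ∧ Set.EqOn Literature.MathematicalPhysics.KineticTheory.hsExcessFreeEnergy F (Set.Ico 0 η₀) ∧ F 0 = 0 ∧ deriv F 0 = 2 * Real.pi / 3 ∧ ∀ η ∈ Set.Ico 0 η₀, Filter.Tendsto (fun N : ℕ => -(N : ℝ)⁻¹ * Real.log (Literature.MathematicalPhysics.KineticTheory.hsFreeVolume η N)) Filter.atTop (nhds (F η))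

/-- `HsEosLowDensity` holds: proved by `Summit.AtomisticToContinuum.HydrodynamicLimit.Theorems.hsEosLowDensity_proof`. -/
theorem HsEosLowDensity_holds : HsEosLowDensity := _root_.Summit.AtomisticToContinuum.HydrodynamicLimit.Theorems.hsEosLowDensity_proof

/-- item stmt-AtomisticToContinuum-0769 · support · rank 9 · closed · proved by Summit.AtomisticToContinuum.HydrodynamicLimit.Theorems.heatBathForgetting_assembly_proof @ 7068fd10e358 (prover) · by planner
sources: KipnisLandim1999, App. 1 Prop. 8.2 p. 328
[assembly] X_RE → HydrodynamicLimit: entropy inequality μ(A) ≤ (log 2 + H(μ|λ))/log(1 + 1/λ(A))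
(from Donsker–Varadhan / Mathlib klDiv API) with λ(A) ≤ C e^{-(N+1)/C} and H = o(N) gives μ(A) → 0;
μ = lawAt (Φ N) P t = P.map (flow t) turns μ{z | δ < |field z − ·|} into P{z | δ < |field (flow t z)
− ·|} (measurable_flow); the reference concentration is stated for z itself and TendstoHydroFieldsAt
at time 0 of the reference law is not needed. Zero-mass case impossible by the IsProbabilityMeasure
clauses; take σ₀ from X_RE. -/
@[route_item "route-AtomisticToContinuum-FluxGibbsianityLdDrude", crux]
def EntropyToFields : Prop :=
  RelEntropyVanishing → Literature.MathematicalPhysics.KineticTheory.HydrodynamicLimit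

/-- `EntropyToFields` holds: proved by `Summit.AtomisticToContinuum.HydrodynamicLimit.Theorems.heatBathForgetting_assembly_proof` @ 7068fd10e358. -/
theorem EntropyToFields_holds : EntropyToFields := _root_.Summit.AtomisticToContinuum.HydrodynamicLimit.Theorems.heatBathForgetting_assembly_proof

-- earlier FastObservableMeanErgodic (stmt-AtomisticToContinuum-9283, replaced 2026-08-15T16:32:25Z -> stmt-AtomisticToContinuum-10952): retired by None — ∀ (a θ : ℝ) (u₀ : Literature.MathematicalPhysics.KineticTheory.V3), 0 < a → 0 < θ → ∃ σ₀ : ℝ, 0 < σ₀ ∧ ∀ σ : ℝ, 0 < σ → σ < σ₀ → (∀ (N : ℕ) (Φ : Literature.Analysis.FluidPDE.HardSphereFlow (Literature.Analysis.FluidPDE.Torus.geometry (Fin 3)) (Lite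
/-- item stmt-AtomisticToContinuum-10952 · support · rank 9 · open · by planner
sources: LepriLiviPoliti2003, §8, Doyon2022, §5.1 Thm 5.1, Spohn1991, Part I Ch. 3
[support] L² SHADOW OF KineticFluxLdDecay (uniform-in-N mean ergodicity of fast one-body
observables; the β²-coefficient of Λ_τ): same setting, no amplitude restriction: for continuous φ,
bounded continuous g ⊥ collisionInvariants, ∀ δ > 0 ∃ τ > 0 ∃ N₀ ∀ N ≥ N₀ ∀ Φ: ∫ ( h⁻¹ ∫_0^h Σ_i
φ(x_i(s)) g((v_i(s)−u₀)/√θ) ds )² dG_N ≤ δ (N+1) (the mean is 0 by invariance and ∫ g d stdGaussian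
= 0, so this is Var/(N+1) → 0 as τ → ∞ uniformly in N). Equivalent to: zero Drude weight (no
conserved quantity of the N-sphere dynamics overlaps the observable, uniformly in N — Mazur/Suzuki,
tree: Literature.Barriers.AtomisticToContinuum.Mazur1969_inequality with von Neumann's mean ergodic
theorem proved there) + uniformly integrable current autocorrelations (finite Green–Kubo integrals;
hydrodynamic long-time tails t^{-3/2} are integrable in d = 3; surviving shear-mode fluctuations
contribute O(τ^{-3/2})). First milestone, cheapest MD test, and the statement a hidden quasi-local
conservation law would refute. A special case in currency (L² instead of LD), not formally implied
by the crux. [deps: none] [difficulty: L] -/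
@[route_item "route-AtomisticToContinuum-FluxGibbsianityLdDrude", crux]
def FastObservableMeanErgodic : Prop :=
  ∀ (a θ : ℝ) (u₀ : Literature.MathematicalPhysics.KineticTheory.V3), 0 < a → 0 < θ → ∃ σ₀ : ℝ, 0 < σ₀ ∧ ∀ σ : ℝ, 0 < σ → σ < σ₀ → (∀ (N : ℕ) (Φ : Literature.Analysis.FluidPDE.HardSphereFlow (Literature.Analysis.FluidPDE.Torus.geometry (Fin 3)) (Literature.MathematicalPhysics.KineticTheory.hsDiameter σ N) (N + 1)), MeasureTheory.IsProbabilityMeasure (Literature.MathematicalPhysics.KineticTheory.localGibbsLaw σ (fun _ => a) (fun _ => u₀) (fun _ => θ) N Φ)) ∧ ∀ (φ : Literature.MathematicalPhysics.KineticTheory.T3 → ℝ) (g : Literature.MathematicalPhysics.KineticTheory.V3 → ℝ), Continuous φ → Continuous g → (∃ K : ℝ, ∀ v, |g v| ≤ K) → (∀ (c₀ c₂ : ℝ) (b : Literature.MathematicalPhysics.KineticTheory.V3), ∫ v, g v * (c₀ + inner ℝ b v + c₂ * ‖v‖ ^ 2) ∂(ProbabilityTheory.stdGaussian Literature.MathematicalPhysics.KineticTheory.V3)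 = 0) → ∀ δ : ℝ, 0 < δ → ∃ τ : ℝ, 0 < τ ∧ ∃ N₀ : ℕ, ∀ N : ℕ, N₀ ≤ N → ∀ Φ : Literature.Analysis.FluidPDE.HardSphereFlow (Literature.Analysis.FluidPDE.Torus.geometry (Fin 3)) (Literature.MathematicalPhysics.KineticTheory.hsDiameter σ N) (N + 1), ∫⁻ z, ENNReal.ofReal (((τ * ((N + 1 : ℕ) : ℝ) ^ (-(1 / 3 : ℝ)))⁻¹ * ∫ s in (0 : ℝ)..(τ * ((N + 1 : ℕ) : ℝ) ^ (-(1 / 3 : ℝ))), ∑ i, φ (Φ.flow s z i).1 * g ((Real.sqrt θ)⁻¹ • ((Φ.flow s z i).2 - u₀))) ^ 2) ∂(Literature.MathematicalPhysics.KineticTheory.localGibbsLaw σ (fun _ => a) (fun _ => u₀) (fun _ => θ) N Φ) ≤ ENNReal.ofReal (δ * (N + 1))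

/-- item stmt-AtomisticToContinuum-17397 · support · rank 9 · open · by planner
sources: Yau1991, §2, KipnisLandim1999, App. 1 Prop. 8.2 p. 328
[support] GUARDED ENTROPY DOCK (packing-guarded twin of the closed glue item
stmt-AtomisticToContinuum-0769 EntropyToFields): RelEntropyVanishingInBand → the re-typed conjunct
`_root_.HydrodynamicLimit`. Proof (8 lines, checked rc 0 in the planner's Sketch.lean, attached as
evidence): take η₀ and σ₀ from the hypothesis; for σ < σ₀, a guarded classical solution, Φ,
convergence at t = 0 and t < T, obtain ⟨a_t, probability, concentration, klDiv → 0⟩ and apply the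
tree lemma Summit.AtomisticToContinuum.HydrodynamicLimit.Theorems.tendstoHydroFieldsAt_of_klDiv
(Theorems/TwoClocksEntropyToHydro.lean: entropy inequality for events μ(A)·L ≤ KL(μ‖ν) + (e^L −
1)ν(A), exponential concentration of the reference, transfer along the measurable flow). Becomes the
last hypothesis of `closes` (replacing EntropyToFields + HydrodynamicLimit.of_unguarded) once crux
#4 is restated to conclude RelEntropyVanishingInBand. [deps: RelEntropyVanishingInBand] [difficulty:
S] -/
@[route_item "route-AtomisticToContinuum-FluxGibbsianityLdDrude"]
def EntropyToFieldsInBand : Prop :=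
  RelEntropyVanishingInBand → _root_.HydrodynamicLimit

/-- item stmt-AtomisticToContinuum-9246 · support · rank 9 · closed · proved by Summit.AtomisticToContinuum.HydrodynamicLimit.Theorems.heatBathForgetting_localGibbsConcentration_proof @ d87eea47b023 (prover) · by planner
sources: Ruelle1969, Ch. 4, Spohn1991, Part I Ch. 3
[support] exponential law of large numbers for canonical local Gibbs states at small reduced density
(shared item stmt-AtomisticToContinuum-0767, same signature; low-density cluster expansion).
[difficulty: M] -/
@[route_item "route-AtomisticToContinuum-FluxGibbsianityLdDrude"]
def LocalGibbsConcentration : Prop :=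
  ∀ (a θ₀ : Literature.MathematicalPhysics.KineticTheory.T3 → ℝ) (u₀ : Literature.MathematicalPhysics.KineticTheory.T3 → Literature.MathematicalPhysics.KineticTheory.V3), Continuous a → Continuous θ₀ → Continuous u₀ → (∀ x, 0 < a x) → (∀ x, 0 < θ₀ x) → ∃ σ₀ : ℝ, 0 < σ₀ ∧ ∀ σ : ℝ, 0 < σ → σ < σ₀ → ∃ ρ₀ : Literature.MathematicalPhysics.KineticTheory.T3 → ℝ, Continuous ρ₀ ∧ (∀ x, 0 < ρ₀ x) ∧ (∀ (N : ℕ) (Φ : Literature.Analysis.FluidPDE.HardSphereFlow (Literature.Analysis.FluidPDE.Torus.geometry (Fin 3)) (Literature.MathematicalPhysics.KineticTheory.hsDiameter σ N) (N + 1)), MeasureTheory.IsProbabilityMeasure (Literature.MathematicalPhysics.KineticTheory.localGibbsLaw σ a u₀ θ₀ N Φ)) ∧ ∀ χ : Literature.MathematicalPhysics.KineticTheory.T3 → ℝ, Continuous χ → ∀ δ : ℝ, 0 < δ → ∃ C : ℝ, 0 < C ∧ ∀ (N : ℕ) (Φ : Literature.Analysis.FluidPDE.HardSphereFlow (Literature.Analysis.FluidPDE.Torus.geometry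 (Fin 3)) (Literature.MathematicalPhysics.KineticTheory.hsDiameter σ N) (N + 1)), Literature.MathematicalPhysics.KineticTheory.localGibbsLaw σ a u₀ θ₀ N Φ {z | δ < |Literature.MathematicalPhysics.KineticTheory.empiricalDensityField z χ - ∫ x, χ x * ρ₀ x|} ≤ ENNReal.ofReal (C * Real.exp (-(C⁻¹ * (N + 1)))) ∧ Literature.MathematicalPhysics.KineticTheory.localGibbsLaw σ a u₀ θ₀ N Φ {z | δ < ‖Literature.MathematicalPhysics.KineticTheory.empiricalMomentumField z χ - ∫ x, (χ x * ρ₀ x) • u₀ x‖} ≤ ENNReal.ofReal (C * Real.exp (-(C⁻¹ * (N + 1)))) ∧ Literature.MathematicalPhysics.KineticTheory.localGibbsLaw σ a u₀ θ₀ N Φ {z | δ < |Literature.MathematicalPhysics.KineticTheory.empiricalEnergyField z χ - ∫ x, χ x * Literature.MathematicalPhysics.KineticTheory.totalEnergyDensity (ρ₀ x) (u₀ x) (θ₀ x)|} ≤ ENNReal.ofReal (C * Real.exp (-(C⁻¹ * (N + 1))))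

/-- `LocalGibbsConcentration` holds: proved by `Summit.AtomisticToContinuum.HydrodynamicLimit.Theorems.heatBathForgetting_localGibbsConcentration_proof` @ d87eea47b023. -/
theorem LocalGibbsConcentration_holds : LocalGibbsConcentration := _root_.Summit.AtomisticToContinuum.HydrodynamicLimit.Theorems.heatBathForgetting_localGibbsConcentration_proof

-- earlier Assembly (stmt-AtomisticToContinuum-9284, replaced 2026-08-16T18:30:36Z -> stmt-AtomisticToContinuum-16320): retired by None — KineticFluxLdDecay → KineticWindowGronwall → EntropyToFields → _root_.HydrodynamicLimit
/-- item stmt-AtomisticToContinuum-16320 · assembly · rank 1 · open · by planner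
sources: KipnisLandim1999, App. 1 Prop. 8.2 p. 328, Yau1991, §2
[assembly] FRAME STATEMENT X → Statement with X = X1 ∧ X2 (thesis): KineticFluxLdDecay →
KineticWindowGronwall → _root_.HydrodynamicLimit. Content = KineticWindowGronwall applied to
KineticFluxLdDecay gives the shared Yau-form target RelEntropyVanishing
(stmt-AtomisticToContinuum-0766), and the entropy-inequality dock RelEntropyVanishing →
HydrodynamicLimit (= the shared item EntropyToFields, stmt-AtomisticToContinuum-0769, CLOSED proved;
in tree:
Summit.AtomisticToContinuum.HydrodynamicLimit.Theorems.hydrodynamicLimit_of_relEntropyVanishing,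
Theorems/TwoClocksEntropyToHydro.lean) gives the conjunct; so this item is provable in one line from
the tree (checked in the planner's Sketch.lean, rc 0) and is NOT a tautology. Restated 2026-08-16
(route-repair, ground-failed): the rev-1 text carried EntropyToFields as a third hypothesis, which
made the item pure logic and h21_ground flagged it ground.trivial (`intros; aesop`); the deciding
theorem `closes : KineticFluxLdDecay → KineticWindowGronwall → EntropyToFields →
_root_.HydrodynamicLimit` (proof fun h₁ h₂ h₃ => h₃ (h₂ h₁)) is unchanged and still certified. The
informal cruxes FluxGibbsianityDuality / CollisionalFluxLdDecay / FirstInte -/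
@[route_item "route-AtomisticToContinuum-FluxGibbsianityLdDrude"]
def Assembly : Prop :=
  KineticFluxLdDecay → KineticWindowGronwall → _root_.HydrodynamicLimit

/-! D-0027 §2.1 — DECIDING THEOREM (planner-authored via `route open/edit --closes-file`; by planner-rrepair-AtomisticToContinuum-FluxGibbs-7404e5b4-0 2026-08-16T23:11:46Z):
its hypotheses are this route's items and its conclusion the sub-problem Statement (glue_lint), and it elaborates with this file. -/

/-- DECIDING THEOREM (D-0027 §2.1): pure logic — `KineticWindowGronwall` turns `KineticFluxLdDecay`
into the shared Yau-form target `RelEntropyVanishing`, `EntropyToFields` (= stmt-AtomisticToContinuum-0769,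
the entropy-inequality glue, closed in tree) turns that into the UNGUARDED Literature conjecture
`Literature.MathematicalPhysics.KineticTheory.HydrodynamicLimit`, and `HydrodynamicLimit.of_unguarded`
(Statement.lean, retype p126922 of 2026-08-16) gives the packing-guarded conjunct `_root_.HydrodynamicLimit`
(the guard hypothesis is simply discarded). -/
@[closes "route-AtomisticToContinuum-FluxGibbsianityLdDrude"] theorem closes (h₁ : KineticFluxLdDecay) (h₂ : KineticWindowGronwall) (h₃ : EntropyToFields) :
    _root_.HydrodynamicLimit :=
  _root_.HydrodynamicLimit.of_unguarded (h₃ (h₂ h₁))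

end Summit.AtomisticToContinuum.HydrodynamicLimit.Theses.FluxGibbsianityLdDrude
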